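import Literature.Analysis.FluidPDE.SelfSimilarEulerLocalEnergyDimension
import HarnessLib

/-!
# Bronzi–Shvydkoy 2015, Remarks 1.2–1.4 and the sublinear-growth criterion in the GENERAL class
# (shell growth, no `L^p` membership), relative to the fact `bronziShvydkoy2015_energy_dichotomy`

Analysis/FluidPDE proof file (theorems only; no definitions, no named facts, no `sorry`) in the
story of `SelfSimilarEulerEnergyConcentration.lean` (the NAMED FACT
`bronziShvydkoy2015_energy_dichotomy` = A. Bronzi, R. Shvydkoy, *On the energy behavior of locally
self-similar blowup for the Euler equation*, Indiana Univ. Math. J. **64** (2015) 1291–1302 =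
arXiv:1310.8611 [BronziShvydkoy2015], **Theorem 1.1**: a locally self-similar blow-up of a
finite-energy Euler solution with profile `v ∈ C³_loc`, `0 < α < 3/2` and the shell growth (1.7)
`∫_{|y|∼L} |v|^p ≲ L^γ`, `p ≥ 3`, `γ < p − 2`, has `v = 0` or `L^{3−2α} ≲ ∫_{|y|<L}|v|² ≲ L^{3−2α}`).

The companion files prove the theorem and its remarks UNCONDITIONALLY in the `L^p` class
(`SelfSimilarEulerEnergyLowerBound.lean`: `bronziShvydkoy2015_dichotomy_of_memLp`, Remarks 1.3 /
1.4 for `U ∈ L^p`, `P ∈ L^{p/2}`; `SelfSimilarEulerLocalEnergyDimension.lean`: Remark 1.2 in the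
`L^p` class). This file records, RELATIVE TO THE FACT (users take
`(h : bronziShvydkoy2015_energy_dichotomy)`, exactly as
`bronziShvydkoy2015_energy_dichotomy.energy_ball_lower_bound` does), what the printed remarks say
in the GENERAL class of the theorem — profiles with mere shell growth, in particular BOUNDED
profiles and profiles of SUBLINEAR growth, which are in no `L^p(ℝ³)`:

* `bronziShvydkoy2015_energy_dichotomy.eq_zero_of_frequently_small` — the contrapositive core of
  (1.8): under the hypotheses of Theorem 1.1, if the rescaled energy `L^{2α−3}∫_{|y|<L}|v|²` is
  frequently small (`liminf = 0`), then `v = 0`.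
* `….eq_zero_of_shellDecay` — **Remark 1.3** ("if in addition `γ < N − pα` … This implies
  `v = 0`"), general class: shell growth with `γ < p − 2` AND `γ < 3 − pα` forces `v = 0`
  (Hölder on shells makes the energy `o(L^{3−2α})`: the tree's `energy_frequently_small_of_shellDecay`).
* `….eq_zero_of_decay` — **Remark 1.4** read as an exclusion ("asymptotic behavior at `∞` should
  be that of `|y|^{−α}` in general. Theorem 1.1 expresses this very fact"), general class: a profile
  decaying pointwise FASTER than the natural rate, `|y|^α |v(y)| → 0`, is trivial — for such a
  profile the shell growth (1.7) holds automatically (`p = 6`, `γ = 3 − 6α < 4`), so NO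
  integrability hypothesis remains.
* `….of_bounded`, `….energy_ball_lower_bound_of_bounded` — BOUNDED profiles satisfy (1.7) with
  `p = 6`, `γ = 3 < p − 2`: every bounded-profile locally self-similar blow-up in the class has
  `v = 0` or the two-sided law (1.8), and (Remark 1.2) a non-trivial one keeps
  `‖u(t)‖_{L²(B_{ρ₀}(x₀))} ≥ c > 0` up to the blow-up time.
* `….of_sublinear`, `….eq_zero_of_sublinear_of_frequently_small` — profiles of SUBLINEAR growth
  `|v(y)| ≲ |y|^{1−δ}`, `0 < δ ≤ 1`, satisfy (1.7) with `p ≥ 6/δ` (`γ = 3 + p(1−δ) < p − 2`); hence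
  the dichotomy, and the printed consequence (held text p. 4, first paragraph): "another
  exclusion condition exhibited in [Shvydkoy 2013]: if `|v(y)| ≲ |y|^{1−δ}` … and
  `∫_{|y|<L}|v|² ≲ L^{N−2α} o(1)` with `α > (N−2)/4`, then `v = 0`. We can now remove the extra
  assumption `α > (N−2)/4`."
* `….localEnergy_two_sided` — **Remark 1.2, local energy dimension**, general class: for a
  non-trivial profile there are `0 < c ≤ C`, `M > 0` with
  `c ρ^{3−2α} ≤ ∫_{B_ρ(x₀)}|u(t)|² ≤ C ρ^{3−2α}` for `0 < ρ ≤ ρ₀`, `T − t ≤ T(ρ/M)^{α+1}`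
  ("`𝓔_T(B_ρ(x₀)) ∼ ρ^{N−2α}` for all small `ρ` … the exact fractal local dimension of `𝓔_T` exists
  at `x₀` and is equal to `D = N − 2α`"); the `L^p`-class version is
  `localEnergy_two_sided_of_locallySelfSimilar_of_memLp`.

All statements keep the fact's rendering of the class (Beale–Kato–Majda classical Euler solution
on `ℝ³ × [0,T)`, exact local ansatz `selfSimilarCollapse (1/(α+1)) T v` on `B_{ρ₀}(x₀)`, `v ∈ C³`,
`0 < α < 3/2`). For the ns-blowup profile census (zones Z5–Z8, hypothesised exact self-similar
EULER collapses read in the BKM class): bounded or sublinearly growing rescaled profiles are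
either trivial or have ball energies EXACTLY of order `L^{5 − 2/c_l}` (`c_l = 1/(1+α)`), and a
profile decaying faster than `|y|^{1 − 1/c_l}` is not a collapse profile — modulo the fact until
`bronziShvydkoy2015_energy_dichotomy_holds` lands (claimed 2026-08-27 by another seat), then
unconditionally. WHAT THIS IS NOT: not a statement about Navier–Stokes.

## Mathlib / tree search

`lean search 'bronziShvydkoy2015_energy_dichotomy'`: the fact, `.energy_ball_lower_bound`,
`.upper_bound`, the `L^p`-class theorems listed above; no general-class remark (2026-08-27).
Reused: `energy_frequently_small_of_shellDecay`, `energy_eventually_small_of_decay`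
(`SelfSimilarEulerEnergyLowerBound.lean`), `localEnergy_eq_of_locallySelfSimilar`,
`collapse_scaling_identity`, `localEnergy_le_of_locallySelfSimilar`
(`SelfSimilarEulerLocalEnergyDimension.lean`), `bronziShvydkoy2015_energy_dichotomy.energy_ball_lower_bound`;
Mathlib `Measure.addHaar_real_closedBall'`, `setIntegral_mono_on`, `Real.rpow_le_rpow_of_exponent_le`.
No new definitions, no instances, no notation.

## References

* A. Bronzi, R. Shvydkoy, Indiana Univ. Math. J. 64 (2015) 1291–1302 = arXiv:1310.8611, §1
  Thm. 1.1 (1.7)–(1.8), Rem. 1.2, Rem. 1.3, Rem. 1.4, and p. 4 (sublinear growth). [BronziShvydkoy2015]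
* R. Shvydkoy, *A study of energy concentration and drain in incompressible fluids*,
  Nonlinearity 26 (2013) 425–436 (the criterion improved on p. 4 of [BronziShvydkoy2015]).
-/

noncomputable section

open MeasureTheory Set Filter Topology Metric
open scoped ENNReal NNReal

namespace Literature.Analysis.FluidPDE

/-! ## Tools: shell integrals of pointwise-bounded powers -/

/-- The open shell `{L < |y| < 2L}` has volume `≤ 8 v₁ L³`, `v₁ = |B̄₁|`. [folklore] -/
private theorem measureReal_shell_le {L : ℝ} (hL : 0 < L) :
    (volume : Measure (EuclideanSpace ℝ (Fin 3))).real
        {y : EuclideanSpace ℝ (Fin 3) | L < ‖y‖ ∧ ‖y‖ < 2 * L} ≤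
      8 * (volume : Measure (EuclideanSpace ℝ (Fin 3))).real
        (closedBall (0 : EuclideanSpace ℝ (Fin 3)) 1) * L ^ 3 := by
  have hSsub : {y : EuclideanSpace ℝ (Fin 3) | L < ‖y‖ ∧ ‖y‖ < 2 * L} ⊆
      closedBall (0 : EuclideanSpace ℝ (Fin 3)) (2 * L) := fun y hy => by
    rw [mem_closedBall_zero_iff]
    exact hy.2.le
  calc (volume : Measure (EuclideanSpace ℝ (Fin 3))).real {y | L < ‖y‖ ∧ ‖y‖ < 2 * L}
      ≤ (volume : Measure (EuclideanSpace ℝ (Fin 3))).real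
          (closedBall (0 : EuclideanSpace ℝ (Fin 3)) (2 * L)) :=
        measureReal_mono hSsub measure_closedBall_lt_top.ne
    _ = 8 * (volume : Measure (EuclideanSpace ℝ (Fin 3))).real
          (closedBall (0 : EuclideanSpace ℝ (Fin 3)) 1) * L ^ 3 := by
        rw [Measure.addHaar_real_closedBall' volume (0 : EuclideanSpace ℝ (Fin 3))
          (by linarith : (0 : ℝ) ≤ 2 * L), finrank_euclideanSpace_fin]
        ring

/-- A pointwise bound `|v(y)|^r ≤ K` on the shell `{L < |y| < 2L}` integrates to
`∫_{L<|y|<2L} |v|^r ≤ K · 8 v₁ L³`. [folklore] -/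
private theorem setIntegral_shell_rpow_le_of_forall_le {r K L : ℝ}
    {v : EuclideanSpace ℝ (Fin 3) → EuclideanSpace ℝ (Fin 3)} (hv : Continuous v) (hr : 0 ≤ r)
    (hL : 0 < L) (hK : 0 ≤ K)
    (hle : ∀ y : EuclideanSpace ℝ (Fin 3), L < ‖y‖ → ‖y‖ < 2 * L → ‖v y‖ ^ r ≤ K) :
    ∫ y in {y : EuclideanSpace ℝ (Fin 3) | L < ‖y‖ ∧ ‖y‖ < 2 * L}, ‖v y‖ ^ r ≤
      K * (8 * (volume : Measure (EuclideanSpace ℝ (Fin 3))).real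
        (closedBall (0 : EuclideanSpace ℝ (Fin 3)) 1) * L ^ 3) := by
  set S : Set (EuclideanSpace ℝ (Fin 3)) := {y | L < ‖y‖ ∧ ‖y‖ < 2 * L} with hS_def
  have hSm : MeasurableSet S :=
    (measurableSet_lt measurable_const continuous_norm.measurable).inter
      (measurableSet_lt continuous_norm.measurable measurable_const)
  have hSsub : S ⊆ closedBall (0 : EuclideanSpace ℝ (Fin 3)) (2 * L) := fun y hy => by
    rw [mem_closedBall_zero_iff]
    exact hy.2.le
  have hSfin : volume S < ∞ := (measure_mono hSsub).trans_lt measure_closedBall_lt_top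
  have hcont : Continuous fun y => ‖v y‖ ^ r := hv.norm.rpow_const fun _ => Or.inr hr
  have hint : IntegrableOn (fun y => ‖v y‖ ^ r) S volume :=
    (hcont.continuousOn.integrableOn_compact (isCompact_closedBall 0 (2 * L))).mono_set hSsub
  have h1 : ∫ y in S, ‖v y‖ ^ r ≤ ∫ _ in S, K :=
    setIntegral_mono_on hint (integrableOn_const hSfin.ne) hSm fun y hy => hle y hy.1 hy.2
  rw [setIntegral_const, smul_eq_mul] at h1
  calc ∫ y in S, ‖v y‖ ^ r ≤ (volume : Measure (EuclideanSpace ℝ (Fin 3))).real S * K := h1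
    _ ≤ (8 * (volume : Measure (EuclideanSpace ℝ (Fin 3))).real
          (closedBall (0 : EuclideanSpace ℝ (Fin 3)) 1) * L ^ 3) * K :=
        mul_le_mul_of_nonneg_right (measureReal_shell_le hL) hK
    _ = K * (8 * (volume : Measure (EuclideanSpace ℝ (Fin 3))).real
          (closedBall (0 : EuclideanSpace ℝ (Fin 3)) 1) * L ^ 3) := mul_comm _ _

/-- **Shell growth (1.7) from a pointwise power bound.** If `|v(y)| ≤ B |y|^s` for `|y| ≥ R`
(`B ≥ 0`, `0 ≤ s`) then for every real `r ≥ 0` and `L ≥ max R 1`,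
`∫_{L<|y|<2L} |v|^r ≤ (B^r 2^{rs} · 8 v₁) L^{3 + r s}`. [folklore] -/
private theorem shellGrowth_of_pow_bound {B s R r : ℝ}
    {v : EuclideanSpace ℝ (Fin 3) → EuclideanSpace ℝ (Fin 3)} (hv : Continuous v) (hB : 0 ≤ B)
    (hs : 0 ≤ s) (hr : 0 ≤ r)
    (hbd : ∀ y : EuclideanSpace ℝ (Fin 3), R ≤ ‖y‖ → ‖v y‖ ≤ B * ‖y‖ ^ s) :
    ∀ L : ℝ, max R 1 ≤ L →
      ∫ y in {y : EuclideanSpace ℝ (Fin 3) | L < ‖y‖ ∧ ‖y‖ < 2 * L}, ‖v y‖ ^ r ≤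
        (B ^ r * 2 ^ (r * s) * (8 * (volume : Measure (EuclideanSpace ℝ (Fin 3))).real
          (closedBall (0 : EuclideanSpace ℝ (Fin 3)) 1))) * L ^ (3 + r * s) := by
  intro L hL
  have hL1 : 1 ≤ L := (le_max_right _ _).trans hL
  have hL0 : 0 < L := by linarith
  have hRL : R ≤ L := (le_max_left _ _).trans hL
  have hK : 0 ≤ B ^ r * (2 * L) ^ (r * s) := by positivity
  have hle : ∀ y : EuclideanSpace ℝ (Fin 3), L < ‖y‖ → ‖y‖ < 2 * L →
      ‖v y‖ ^ r ≤ B ^ r * (2 * L) ^ (r * s) := by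
    intro y h1 h2
    have hy0 : 0 ≤ ‖y‖ := norm_nonneg _
    have hvy : ‖v y‖ ≤ B * ‖y‖ ^ s := hbd y (by linarith)
    calc ‖v y‖ ^ r ≤ (B * ‖y‖ ^ s) ^ r := Real.rpow_le_rpow (norm_nonneg _) hvy hr
      _ = B ^ r * (‖y‖ ^ s) ^ r := Real.mul_rpow hB (Real.rpow_nonneg hy0 _)
      _ = B ^ r * ‖y‖ ^ (r * s) := by rw [← Real.rpow_mul hy0, mul_comm s r]
      _ ≤ B ^ r * (2 * L) ^ (r * s) :=
          mul_le_mul_of_nonneg_left (Real.rpow_le_rpow hy0 h2.le (by positivity))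
            (by positivity)
  have h := setIntegral_shell_rpow_le_of_forall_le hv hr hL0 hK hle
  have e : B ^ r * (2 * L) ^ (r * s) * (8 * (volume : Measure (EuclideanSpace ℝ (Fin 3))).real
        (closedBall (0 : EuclideanSpace ℝ (Fin 3)) 1) * L ^ 3) =
      (B ^ r * 2 ^ (r * s) * (8 * (volume : Measure (EuclideanSpace ℝ (Fin 3))).real
        (closedBall (0 : EuclideanSpace ℝ (Fin 3)) 1))) * L ^ (3 + r * s) := by
    have h3 : L ^ (3 : ℝ) = L ^ 3 := by exact_mod_cast Real.rpow_natCast L 3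
    rw [Real.mul_rpow (by norm_num) hL0.le, Real.rpow_add hL0, h3]
    ring
  rw [e] at h
  exact h

/-! ## The contrapositive core of (1.8): a frequently small rescaled energy forces `v = 0` -/

/-- **BS15 Theorem 1.1, contrapositive core (general class, relative to the fact).** Under the
hypotheses of `bronziShvydkoy2015_energy_dichotomy` (BKM-class Euler solution, exact local
self-similarity on `B_{ρ₀}(x₀)`, `v ∈ C³`, `0 < α < 3/2`, shell growth (1.7)): if the rescaled ball
energies `L^{2α−3} ∫_{|y|<L} |v|²` are frequently small as `L → ∞` ("Assuming, on the contrary,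
that there is a sequence of `L_n`'s so that `L_n^{2α−N}⟨|v|²⟩_{L_n}·L_n^{...} → 0` …"), then `v = 0`
(the lower bound in (1.8) fails along the sequence). [cite: BronziShvydkoy2015, §1 Thm. 1.1 (1.8) and §3] -/
theorem bronziShvydkoy2015_energy_dichotomy.eq_zero_of_frequently_small
    (h : bronziShvydkoy2015_energy_dichotomy) {T α ρ₀ : ℝ} {x₀ : EuclideanSpace ℝ (Fin 3)}
    {u : ℝ → EuclideanSpace ℝ (Fin 3) → EuclideanSpace ℝ (Fin 3)}
    {p : ℝ → EuclideanSpace ℝ (Fin 3) → ℝ}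
    {v : EuclideanSpace ℝ (Fin 3) → EuclideanSpace ℝ (Fin 3)}
    (hT : 0 < T) (hα : 0 < α) (hα' : α < 3 / 2) (hρ₀ : 0 < ρ₀)
    (hsol : IsClassicalEulerSolutionOn (Ico 0 T) 0 u p)
    (hreg : ∀ T'' < T, HasBoundedSobolevNormsOn (Icc 0 T'') u)
    (hv3 : ContDiff ℝ 3 v)
    (hss : ∀ t ∈ Ico 0 T, ∀ x ∈ ball x₀ ρ₀,
      u t x = selfSimilarCollapse (1 / (α + 1)) T v t (x - x₀))
    (hgrowth : ∃ r γ C L₀ : ℝ, 3 ≤ r ∧ γ < r - 2 ∧ ∀ L : ℝ, L₀ ≤ L →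
      ∫ y in {y : EuclideanSpace ℝ (Fin 3) | L < ‖y‖ ∧ ‖y‖ < 2 * L}, ‖v y‖ ^ r ≤ C * L ^ γ)
    (hsmall : ∀ ε : ℝ, 0 < ε → ∀ M : ℝ, ∃ L : ℝ, M ≤ L ∧
      L ^ (2 * α - 3) * ∫ y in ball (0 : EuclideanSpace ℝ (Fin 3)) L, ‖v y‖ ^ 2 ≤ ε) :
    v = 0 := by
  rcases h T α ρ₀ x₀ u p v hT hα hα' hρ₀ hsol hreg hv3 hss hgrowth with h0 | ⟨c, C, L₀, hc, hbd⟩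
  · exact h0
  · exfalso
    obtain ⟨L, hML, hL⟩ := hsmall (c / 2) (by positivity) (max L₀ 1)
    have hL1 : 1 ≤ L := (le_max_right _ _).trans hML
    have hL0 : 0 < L := by linarith
    have hlow : c * L ^ (3 - 2 * α) ≤ ∫ y in ball (0 : EuclideanSpace ℝ (Fin 3)) L, ‖v y‖ ^ 2 :=
      (hbd L ((le_max_left _ _).trans hML)).1
    have hpow : 0 < L ^ (2 * α - 3) := Real.rpow_pos_of_pos hL0 _
    have hone : L ^ (2 * α - 3) * L ^ (3 - 2 * α) = 1 := by
      rw [← Real.rpow_add hL0, show 2 * α - 3 + (3 - 2 * α) = 0 by ring, Real.rpow_zero]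
    have : c ≤ c / 2 :=
      calc c = L ^ (2 * α - 3) * (c * L ^ (3 - 2 * α)) := by
            rw [mul_left_comm, hone, mul_one]
        _ ≤ L ^ (2 * α - 3) * ∫ y in ball (0 : EuclideanSpace ℝ (Fin 3)) L, ‖v y‖ ^ 2 :=
            mul_le_mul_of_nonneg_left hlow hpow.le
        _ ≤ c / 2 := hL
    linarith

/-! ## Remark 1.3 (general class): extra shell decay `γ < 3 − pα` forces `v = 0` -/

/-- **Bronzi–Shvydkoy 2015, Remark 1.3 (general class, relative to the fact).** "Theorem 1.1 can
serve as an exclusion result in those cases when (1.8) is not valid a priori. For example, if in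
addition `γ < N − pα` … then by the Hölder [inequality] one also has
`∫_{|y|∼L}|v|² ≲ L^{N−2α} o(1)`. Consequently, since `α < N/2`, `∫_{|y|<L}|v|² ≲ L^{N−2α} o(1)`,
invalidating the lower bound in (1.8). This implies `v = 0`." Statement: under the hypotheses of
`bronziShvydkoy2015_energy_dichotomy` with the shell growth `∫_{L<|y|<2L}|v|^r ≤ C L^γ`, `3 ≤ r`,
`γ < r − 2` AND `γ < 3 − rα`, the profile vanishes. (The `L^p`-class version, unconditional, is
`IsSelfSimilarEulerProfile.eq_zero_of_memLp_of_shellDecay`.) [cite: BronziShvydkoy2015, §1 Rem. 1.3] -/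
theorem bronziShvydkoy2015_energy_dichotomy.eq_zero_of_shellDecay
    (h : bronziShvydkoy2015_energy_dichotomy) {T α ρ₀ : ℝ} {x₀ : EuclideanSpace ℝ (Fin 3)}
    {u : ℝ → EuclideanSpace ℝ (Fin 3) → EuclideanSpace ℝ (Fin 3)}
    {p : ℝ → EuclideanSpace ℝ (Fin 3) → ℝ}
    {v : EuclideanSpace ℝ (Fin 3) → EuclideanSpace ℝ (Fin 3)}
    (hT : 0 < T) (hα : 0 < α) (hα' : α < 3 / 2) (hρ₀ : 0 < ρ₀)
    (hsol : IsClassicalEulerSolutionOn (Ico 0 T) 0 u p)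
    (hreg : ∀ T'' < T, HasBoundedSobolevNormsOn (Icc 0 T'') u)
    (hv3 : ContDiff ℝ 3 v)
    (hss : ∀ t ∈ Ico 0 T, ∀ x ∈ ball x₀ ρ₀,
      u t x = selfSimilarCollapse (1 / (α + 1)) T v t (x - x₀))
    {r γ C L₀ : ℝ} (hr : 3 ≤ r) (hγ : γ < r - 2) (hγ' : γ < 3 - r * α)
    (hdecay : ∀ L : ℝ, L₀ ≤ L →
      ∫ y in {y : EuclideanSpace ℝ (Fin 3) | L < ‖y‖ ∧ ‖y‖ < 2 * L}, ‖v y‖ ^ r ≤ C * L ^ γ) :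
    v = 0 :=
  h.eq_zero_of_frequently_small hT hα hα' hρ₀ hsol hreg hv3 hss ⟨r, γ, C, L₀, hr, hγ, hdecay⟩
    (energy_frequently_small_of_shellDecay (hv3.continuous) (by linarith) hα' hγ' hdecay)

/-- **Hölder against `1`** (copy of the private tool of `SelfSimilarEulerEnergyLowerBound.lean`):
for `1 < r`, `φ ≥ 0` with `φ ∈ L^r(S)` and `|S| < ∞`, `∫_S φ ≤ (∫_S φ^r)^{1/r} |S|^{1 − 1/r}`.
[folklore] -/
private theorem setIntegral_le_rpow_mul_measureReal_rpow'' {r : ℝ} (hr : 1 < r)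
    {φ : EuclideanSpace ℝ (Fin 3) → ℝ} {S : Set (EuclideanSpace ℝ (Fin 3))}
    (hS : volume S ≠ ⊤) (hφ0 : ∀ y, 0 ≤ φ y)
    (hφ : MemLp φ (ENNReal.ofReal r) (volume.restrict S)) :
    ∫ y in S, φ y ≤ (∫ y in S, φ y ^ r) ^ (1 / r) * (volume.real S) ^ (1 - 1 / r) := by
  haveI : IsFiniteMeasure (volume.restrict S) := isFiniteMeasure_restrict.2 hS
  have hpq : Real.HolderConjugate r (Real.conjExponent r) := Real.HolderConjugate.conjExponent hr
  have h := integral_mul_le_Lp_mul_Lq_of_nonneg (μ := volume.restrict S) hpq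
    (f := φ) (g := fun _ => (1 : ℝ))
    (Eventually.of_forall hφ0) (Eventually.of_forall fun _ => zero_le_one) hφ (memLp_const 1)
  have he : 1 / Real.conjExponent r = 1 - 1 / r := by
    have h1 := hpq.inv_add_inv_eq_inv
    rw [inv_one] at h1
    rw [one_div, one_div]
    linarith
  simp only [mul_one, Real.one_rpow, integral_const, smul_eq_mul,
    measureReal_restrict_apply_univ, he] at h
  exact h

/-- **Hölder against `1` for `|v|²` on a shell, exponent `r/2`**: for `r > 2`, `v` continuous and
`L > 0`, `∫_{L<|y|<2L} |v|² ≤ (∫_{L<|y|<2L} |v|^r)^{2/r} (8 v₁ L³)^{1 − 2/r}`. [folklore] -/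
private theorem setIntegral_shell_norm_sq_le {r L : ℝ} (hr : 2 < r) (hL : 0 < L)
    {v : EuclideanSpace ℝ (Fin 3) → EuclideanSpace ℝ (Fin 3)} (hv : Continuous v) :
    ∫ y in {y : EuclideanSpace ℝ (Fin 3) | L < ‖y‖ ∧ ‖y‖ < 2 * L}, ‖v y‖ ^ 2 ≤
      (∫ y in {y : EuclideanSpace ℝ (Fin 3) | L < ‖y‖ ∧ ‖y‖ < 2 * L}, ‖v y‖ ^ r) ^ (2 / r) *
        (8 * (volume : Measure (EuclideanSpace ℝ (Fin 3))).real
          (closedBall (0 : EuclideanSpace ℝ (Fin 3)) 1) * L ^ 3) ^ (1 - 2 / r) := by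
  set S : Set (EuclideanSpace ℝ (Fin 3)) := {y | L < ‖y‖ ∧ ‖y‖ < 2 * L} with hS_def
  have hSsub : S ⊆ closedBall (0 : EuclideanSpace ℝ (Fin 3)) (2 * L) := fun y hy => by
    rw [mem_closedBall_zero_iff]
    exact hy.2.le
  have hSbdd : Bornology.IsBounded S := isBounded_closedBall.subset hSsub
  have hr2 : 1 < r / 2 := by
    rw [lt_div_iff₀ two_pos]
    linarith
  have hφ : MemLp (fun y => ‖v y‖ ^ 2) (ENNReal.ofReal (r / 2)) (volume.restrict S) :=
    memLp_restrict_of_continuous_isBounded (hv.norm.pow 2) hSbdd _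
  have h := setIntegral_le_rpow_mul_measureReal_rpow'' hr2 hSbdd.measure_lt_top.ne
    (fun y => sq_nonneg _) hφ
  have e : ∀ y : EuclideanSpace ℝ (Fin 3), (‖v y‖ ^ 2) ^ (r / 2) = ‖v y‖ ^ r := fun y => by
    rw [← Real.rpow_natCast, ← Real.rpow_mul (norm_nonneg _)]
    congr 1
    push_cast
    ring
  have e1 : 1 / (r / 2) = 2 / r := by
    rw [one_div, inv_div]
  simp only [e, e1] at h
  have h12 : 0 ≤ 1 - 2 / r := by
    rw [sub_nonneg, div_le_one (by linarith)]
    linarith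
  exact h.trans (mul_le_mul_of_nonneg_left
    (Real.rpow_le_rpow measureReal_nonneg (measureReal_shell_le hL) h12)
    (Real.rpow_nonneg (integral_nonneg fun y => by positivity) _))

/-- **Bronzi–Shvydkoy 2015, Remark 1.3, endpoint case (general class, relative to the fact).**
"… or if `γ = N − pα` and `∫_{|y|∼L}|v(y)|^p dy ≲ o(1)` [i.e. `o(L^{N−pα})`] (in which case
necessarily `N < pα + p − 2`), then by the Hölder [inequality] one also has
`∫_{|y|∼L}|v|² ≲ L^{N−2α} o(1)` … This implies `v = 0`." Statement: under the hypotheses of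
`bronziShvydkoy2015_energy_dichotomy` except (1.7), with `3 ≤ r`, `3 − rα < r − 2` and
`∫_{L<|y|<2L}|v|^r ≤ ε L^{3−rα}` for every `ε > 0` and all large `L`, the profile vanishes (the shell
energies are `≤ δ L^{3−2α}` with `δ` small, hence `L^{2α−3}∫_{|y|<L}|v|²` is eventually small by
`ball_energy_le_of_shellEnergy_le`; (1.7) holds with `γ = 3 − rα`).
[cite: BronziShvydkoy2015, §1 Rem. 1.3 (endpoint `γ = N − pα`)] -/
theorem bronziShvydkoy2015_energy_dichotomy.eq_zero_of_shellLittleO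
    (h : bronziShvydkoy2015_energy_dichotomy) {T α ρ₀ : ℝ} {x₀ : EuclideanSpace ℝ (Fin 3)}
    {u : ℝ → EuclideanSpace ℝ (Fin 3) → EuclideanSpace ℝ (Fin 3)}
    {p : ℝ → EuclideanSpace ℝ (Fin 3) → ℝ}
    {v : EuclideanSpace ℝ (Fin 3) → EuclideanSpace ℝ (Fin 3)}
    (hT : 0 < T) (hα : 0 < α) (hα' : α < 3 / 2) (hρ₀ : 0 < ρ₀)
    (hsol : IsClassicalEulerSolutionOn (Ico 0 T) 0 u p)
    (hreg : ∀ T'' < T, HasBoundedSobolevNormsOn (Icc 0 T'') u)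
    (hv3 : ContDiff ℝ 3 v)
    (hss : ∀ t ∈ Ico 0 T, ∀ x ∈ ball x₀ ρ₀,
      u t x = selfSimilarCollapse (1 / (α + 1)) T v t (x - x₀))
    {r : ℝ} (hr : 3 ≤ r) (hwin : 3 - r * α < r - 2)
    (hlittle : ∀ ε : ℝ, 0 < ε → ∃ L₁ : ℝ, ∀ L : ℝ, L₁ ≤ L →
      ∫ y in {y : EuclideanSpace ℝ (Fin 3) | L < ‖y‖ ∧ ‖y‖ < 2 * L}, ‖v y‖ ^ r ≤
        ε * L ^ (3 - r * α)) :
    v = 0 := by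
  have hvc : Continuous v := hv3.continuous
  have hr0 : 0 < r := by linarith
  -- (1.7) with `γ = 3 − rα` (take `ε = 1`)
  obtain ⟨L₁, hL₁⟩ := hlittle 1 one_pos
  have hgrowth : ∃ r' γ C L₀ : ℝ, 3 ≤ r' ∧ γ < r' - 2 ∧ ∀ L : ℝ, L₀ ≤ L →
      ∫ y in {y : EuclideanSpace ℝ (Fin 3) | L < ‖y‖ ∧ ‖y‖ < 2 * L}, ‖v y‖ ^ r' ≤ C * L ^ γ :=
    ⟨r, 3 - r * α, 1, L₁, hr, hwin, hL₁⟩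
  refine h.eq_zero_of_frequently_small hT hα hα' hρ₀ hsol hreg hv3 hss hgrowth fun ε hε M => ?_
  -- constants
  set v₁ : ℝ := (volume : Measure (EuclideanSpace ℝ (Fin 3))).real
    (closedBall (0 : EuclideanSpace ℝ (Fin 3)) 1) with hv₁_def
  have hv₁ : 0 ≤ v₁ := measureReal_nonneg
  set e : ℝ := 3 - 2 * α with he_def
  have he : 0 < e := by rw [he_def]; linarith
  set K : ℝ := (2 : ℝ) ^ e / ((2 : ℝ) ^ e - 1) with hK_def
  have hK1 : 1 < (2 : ℝ) ^ e := Real.one_lt_rpow (by norm_num) he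
  have hK : 0 ≤ K := div_nonneg (by positivity) (by linarith)
  have h12 : 0 ≤ 1 - 2 / r := by
    rw [sub_nonneg, div_le_one hr0]
    linarith
  -- the shell smallness parameter `η`: `η^{2/r} (8 v₁)^{1 − 2/r} = δ` with `K δ ≤ ε/2`
  set δ : ℝ := ε / (2 * (K + 1)) with hδ_def
  have hδ : 0 < δ := by positivity
  have hKδ : K * δ ≤ ε / 2 := by
    rw [hδ_def]
    rw [show K * (ε / (2 * (K + 1))) = ε / 2 * (K / (K + 1)) by field_simp]
    have : K / (K + 1) ≤ 1 := by
      rw [div_le_one (by positivity)]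
      linarith
    exact mul_le_of_le_one_right (by positivity) this
  set A : ℝ := (8 * v₁) ^ (1 - 2 / r) with hA_def
  have hA : 0 ≤ A := by positivity
  set η : ℝ := (δ / (A + 1)) ^ (r / 2) with hη_def
  have hη : 0 < η := Real.rpow_pos_of_pos (by positivity) _
  have hηA : η ^ (2 / r) * A ≤ δ := by
    rw [hη_def, ← Real.rpow_mul (by positivity), show r / 2 * (2 / r) = 1 by field_simp,
      Real.rpow_one]
    rw [div_mul_eq_mul_div, div_le_iff₀ (by positivity)]
    nlinarith
  obtain ⟨L₂, hL₂⟩ := hlittle η hη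
  set L₃ : ℝ := max L₂ 1 with hL₃_def
  have hL₃0 : 0 < L₃ := lt_of_lt_of_le one_pos (le_max_right _ _)
  -- shell energies `≤ δ L^{3−2α}` for `L ≥ L₃`
  have hshell : ∀ L : ℝ, L₃ ≤ L →
      ∫ y in {y : EuclideanSpace ℝ (Fin 3) | L < ‖y‖ ∧ ‖y‖ < 2 * L}, ‖v y‖ ^ 2 ≤ δ * L ^ e := by
    intro L hL
    have hL1 : 1 ≤ L := (le_max_right _ _).trans hL
    have hL0 : 0 < L := by linarith
    have hH := setIntegral_shell_norm_sq_le (by linarith : (2 : ℝ) < r) hL0 hvc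
    have hIp : (∫ y in {y : EuclideanSpace ℝ (Fin 3) | L < ‖y‖ ∧ ‖y‖ < 2 * L}, ‖v y‖ ^ r) ^ (2 / r)
        ≤ (η * L ^ (3 - r * α)) ^ (2 / r) :=
      Real.rpow_le_rpow (integral_nonneg fun y => by positivity)
        (hL₂ L ((le_max_left _ _).trans hL)) (by positivity)
    have hIp' : (η * L ^ (3 - r * α)) ^ (2 / r) = η ^ (2 / r) * L ^ ((3 - r * α) * (2 / r)) := by
      rw [Real.mul_rpow hη.le (Real.rpow_nonneg hL0.le _), ← Real.rpow_mul hL0.le]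
    have hV : (8 * v₁ * L ^ 3) ^ (1 - 2 / r) = A * L ^ (3 * (1 - 2 / r)) := by
      rw [hA_def, Real.mul_rpow (by positivity) (by positivity), ← Real.rpow_natCast L 3,
        ← Real.rpow_mul hL0.le]
      push_cast
      ring_nf
    have hexp : L ^ ((3 - r * α) * (2 / r)) * L ^ (3 * (1 - 2 / r)) = L ^ e := by
      rw [← Real.rpow_add hL0, he_def]
      congr 1
      field_simp
      ring
    calc ∫ y in {y : EuclideanSpace ℝ (Fin 3) | L < ‖y‖ ∧ ‖y‖ < 2 * L}, ‖v y‖ ^ 2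
        ≤ (∫ y in {y : EuclideanSpace ℝ (Fin 3) | L < ‖y‖ ∧ ‖y‖ < 2 * L}, ‖v y‖ ^ r) ^ (2 / r) *
            (8 * v₁ * L ^ 3) ^ (1 - 2 / r) := hH
      _ ≤ (η ^ (2 / r) * L ^ ((3 - r * α) * (2 / r))) * (A * L ^ (3 * (1 - 2 / r))) := by
          rw [← hIp', ← hV]
          exact mul_le_mul_of_nonneg_right hIp (Real.rpow_nonneg (by positivity) _)
      _ = (η ^ (2 / r) * A) * (L ^ ((3 - r * α) * (2 / r)) * L ^ (3 * (1 - 2 / r))) := by ring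
      _ = (η ^ (2 / r) * A) * L ^ e := by rw [hexp]
      _ ≤ δ * L ^ e := mul_le_mul_of_nonneg_right hηA (Real.rpow_nonneg hL0.le _)
  -- dyadic summation: `E(L) ≤ E(L₃) + K δ L^e` for `L ≥ L₃`
  have hball := ball_energy_le_of_shellEnergy_le hvc hα' hL₃0 hδ.le hshell
  -- choose `L` large: `L ≥ max M L₃` with `L^{2α−3} E(L₃) ≤ ε/2`
  set E₃ : ℝ := ∫ y in ball (0 : EuclideanSpace ℝ (Fin 3)) L₃, ‖v y‖ ^ 2 with hE₃_def
  have hE₃ : 0 ≤ E₃ := integral_nonneg fun y => by positivity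
  -- `L := max (max M L₃) ((2 (E₃+1)/ε)^{1/e})` works: `L^{-e} (E₃) ≤ ε/2`
  set L : ℝ := max (max M L₃) ((2 * (E₃ + 1) / ε) ^ (1 / e)) with hL_def
  have hLM : M ≤ L := (le_max_left _ _).trans (le_max_left _ _)
  have hL₃L : L₃ ≤ L := (le_max_right _ _).trans (le_max_left _ _)
  have hL0 : 0 < L := lt_of_lt_of_le hL₃0 hL₃L
  have hLpow : 2 * (E₃ + 1) / ε ≤ L ^ e := by
    have h1 : (2 * (E₃ + 1) / ε) ^ (1 / e) ≤ L := le_max_right _ _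
    have h2 := Real.rpow_le_rpow (by positivity) h1 he.le
    rwa [← Real.rpow_mul (by positivity), show 1 / e * e = 1 by field_simp, Real.rpow_one] at h2
  refine ⟨L, hLM, ?_⟩
  have hEL := hball L hL₃L
  have hLe : 0 < L ^ e := Real.rpow_pos_of_pos hL0 _
  have hinv : L ^ (2 * α - 3) = (L ^ e)⁻¹ := by
    rw [he_def, ← Real.rpow_neg hL0.le]
    congr 1
    ring
  rw [hinv, inv_mul_le_iff₀ hLe]
  have h1 : E₃ ≤ ε / 2 * L ^ e := by
    have : 2 * (E₃ + 1) ≤ ε * L ^ e := by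
      have := (div_le_iff₀ hε).1 hLpow
      linarith
    nlinarith
  calc ∫ y in ball (0 : EuclideanSpace ℝ (Fin 3)) L, ‖v y‖ ^ 2
      ≤ E₃ + (2 : ℝ) ^ (3 - 2 * α) / ((2 : ℝ) ^ (3 - 2 * α) - 1) * δ * L ^ (3 - 2 * α) := hEL
    _ = E₃ + K * δ * L ^ e := by rw [hK_def, he_def]
    _ ≤ ε / 2 * L ^ e + ε / 2 * L ^ e := by
        have := mul_le_mul_of_nonneg_right hKδ hLe.le
        linarith
    _ = L ^ e * ε := by ring

/-! ## Remark 1.4 (general class): decay faster than `|y|^{−α}` forces `v = 0` -/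

/-- **Bronzi–Shvydkoy 2015, Remark 1.4 as an exclusion (general class, relative to the fact).**
"asymptotic behavior at `∞` should be that of `|y|^{−α}` in general. Theorem 1.1 expresses this very
fact only phrased in terms of `L²`-averages: `(1/L^N)∫_{|y|<L}|v|² ∼ L^{−2α}`." Statement: under
the hypotheses of `bronziShvydkoy2015_energy_dichotomy` EXCEPT the shell growth (1.7) — which here
holds automatically with `p = 6`, `γ = 3 − 6α < 4` — a profile with `|y|^α |v(y)| → 0` as
`|y| → ∞` vanishes identically: the rescaled energy tends to `0`
(`energy_eventually_small_of_decay`), invalidating the lower bound in (1.8). No integrability of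
`v` is assumed. (The `L^p`-class version, unconditional, is
`IsSelfSimilarEulerProfile.eq_zero_of_memLp_of_decay`.) [cite: BronziShvydkoy2015, §1 Rem. 1.4 with Thm. 1.1] -/
theorem bronziShvydkoy2015_energy_dichotomy.eq_zero_of_decay
    (h : bronziShvydkoy2015_energy_dichotomy) {T α ρ₀ : ℝ} {x₀ : EuclideanSpace ℝ (Fin 3)}
    {u : ℝ → EuclideanSpace ℝ (Fin 3) → EuclideanSpace ℝ (Fin 3)}
    {p : ℝ → EuclideanSpace ℝ (Fin 3) → ℝ}
    {v : EuclideanSpace ℝ (Fin 3) → EuclideanSpace ℝ (Fin 3)}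
    (hT : 0 < T) (hα : 0 < α) (hα' : α < 3 / 2) (hρ₀ : 0 < ρ₀)
    (hsol : IsClassicalEulerSolutionOn (Ico 0 T) 0 u p)
    (hreg : ∀ T'' < T, HasBoundedSobolevNormsOn (Icc 0 T'') u)
    (hv3 : ContDiff ℝ 3 v)
    (hss : ∀ t ∈ Ico 0 T, ∀ x ∈ ball x₀ ρ₀,
      u t x = selfSimilarCollapse (1 / (α + 1)) T v t (x - x₀))
    (hdecay : ∀ η : ℝ, 0 < η → ∃ R : ℝ, ∀ y : EuclideanSpace ℝ (Fin 3), R ≤ ‖y‖ →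
      ‖y‖ ^ α * ‖v y‖ ≤ η) :
    v = 0 := by
  have hvc : Continuous v := hv3.continuous
  -- shell growth with `r = 6`, `γ = 3 − 6α` from `|v(y)| ≤ |y|^{−α}` beyond some radius
  obtain ⟨R, hR⟩ := hdecay 1 one_pos
  have hbd : ∀ y : EuclideanSpace ℝ (Fin 3), max R 1 ≤ ‖y‖ → ‖v y‖ ≤ 1 * ‖y‖ ^ (-α) := by
    intro y hy
    have hy1 : 1 ≤ ‖y‖ := (le_max_right _ _).trans hy
    have hy0 : 0 < ‖y‖ := by linarith
    have h1 := hR y ((le_max_left _ _).trans hy)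
    have hpos : 0 < ‖y‖ ^ α := Real.rpow_pos_of_pos hy0 _
    rw [one_mul, Real.rpow_neg hy0.le, inv_eq_one_div, le_div_iff₀ hpos, mul_comm]
    exact h1
  -- `|v(y)|^6 ≤ |y|^{-6α} ≤ L^{-6α}` on the shell is packaged through the power bound with `s = 0`
  -- after factoring: use the bound `|v(y)| ≤ L^{-α}` shell by shell
  have hgrowth : ∃ r γ C L₀ : ℝ, 3 ≤ r ∧ γ < r - 2 ∧ ∀ L : ℝ, L₀ ≤ L →
      ∫ y in {y : EuclideanSpace ℝ (Fin 3) | L < ‖y‖ ∧ ‖y‖ < 2 * L}, ‖v y‖ ^ (r : ℝ) ≤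
        C * L ^ γ := by
    refine ⟨6, 3 - 6 * α, 8 * (volume : Measure (EuclideanSpace ℝ (Fin 3))).real
        (closedBall (0 : EuclideanSpace ℝ (Fin 3)) 1), max R 1, by norm_num, by linarith,
      fun L hL => ?_⟩
    have hL1 : 1 ≤ L := (le_max_right _ _).trans hL
    have hL0 : 0 < L := by linarith
    have hK : 0 ≤ L ^ (-(6 * α)) := Real.rpow_nonneg hL0.le _
    have hle : ∀ y : EuclideanSpace ℝ (Fin 3), L < ‖y‖ → ‖y‖ < 2 * L →
        ‖v y‖ ^ (6 : ℝ) ≤ L ^ (-(6 * α)) := by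
      intro y h1 _
      have hy0 : 0 < ‖y‖ := by linarith
      have hvy : ‖v y‖ ≤ ‖y‖ ^ (-α) := by
        have := hbd y (by linarith)
        rwa [one_mul] at this
      calc ‖v y‖ ^ (6 : ℝ) ≤ (‖y‖ ^ (-α)) ^ (6 : ℝ) :=
            Real.rpow_le_rpow (norm_nonneg _) hvy (by norm_num)
        _ = ‖y‖ ^ (-(6 * α)) := by rw [← Real.rpow_mul hy0.le]; ring_nf
        _ ≤ L ^ (-(6 * α)) :=
            Real.rpow_le_rpow_of_nonpos hL0 h1.le (by linarith)
    have h1 := setIntegral_shell_rpow_le_of_forall_le hvc (by norm_num) hL0 hK hle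
    have e : L ^ (-(6 * α)) * (8 * (volume : Measure (EuclideanSpace ℝ (Fin 3))).real
          (closedBall (0 : EuclideanSpace ℝ (Fin 3)) 1) * L ^ 3) =
        8 * (volume : Measure (EuclideanSpace ℝ (Fin 3))).real
          (closedBall (0 : EuclideanSpace ℝ (Fin 3)) 1) * L ^ (3 - 6 * α) := by
      have h3 : L ^ (3 : ℝ) = L ^ 3 := by exact_mod_cast Real.rpow_natCast L 3
      rw [show (3 : ℝ) - 6 * α = -(6 * α) + 3 by ring, Real.rpow_add hL0, h3]
      ring
    rw [e] at h1
    exact h1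
  have hsmall' := energy_eventually_small_of_decay hvc hα.le hα' hdecay
  refine h.eq_zero_of_frequently_small hT hα hα' hρ₀ hsol hreg hv3 hss hgrowth fun ε hε M => ?_
  obtain ⟨M', hM'⟩ := hsmall' ε hε
  exact ⟨max M M', le_max_left _ _, hM' _ (le_max_right _ _)⟩

/-! ## Bounded profiles: (1.7) holds with `p = 6`, `γ = 3` -/

/-- **BS15 Theorem 1.1 for BOUNDED profiles (relative to the fact).** A bounded profile,
`|v(y)| ≤ B`, satisfies the shell growth (1.7) with `p = 6`, `γ = 3 < p − 2`
(`∫_{L<|y|<2L}|v|⁶ ≤ B⁶ · 8 v₁ L³`); hence, under the remaining hypotheses of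
`bronziShvydkoy2015_energy_dichotomy`, either `v = 0` or
`c L^{3−2α} ≤ ∫_{|y|<L}|v|² ≤ C L^{3−2α}` for all large `L` with `c > 0`. Bounded profiles are in
no `L^p(ℝ³)` in general — this is a case of the printed theorem outside the `L^p` class of
`bronziShvydkoy2015_dichotomy_of_memLp`. [cite: BronziShvydkoy2015, §1 Thm. 1.1 (1.7)–(1.8)] -/
theorem bronziShvydkoy2015_energy_dichotomy.of_bounded
    (h : bronziShvydkoy2015_energy_dichotomy) {T α ρ₀ : ℝ} {x₀ : EuclideanSpace ℝ (Fin 3)}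
    {u : ℝ → EuclideanSpace ℝ (Fin 3) → EuclideanSpace ℝ (Fin 3)}
    {p : ℝ → EuclideanSpace ℝ (Fin 3) → ℝ}
    {v : EuclideanSpace ℝ (Fin 3) → EuclideanSpace ℝ (Fin 3)}
    (hT : 0 < T) (hα : 0 < α) (hα' : α < 3 / 2) (hρ₀ : 0 < ρ₀)
    (hsol : IsClassicalEulerSolutionOn (Ico 0 T) 0 u p)
    (hreg : ∀ T'' < T, HasBoundedSobolevNormsOn (Icc 0 T'') u)
    (hv3 : ContDiff ℝ 3 v)
    (hss : ∀ t ∈ Ico 0 T, ∀ x ∈ ball x₀ ρ₀,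
      u t x = selfSimilarCollapse (1 / (α + 1)) T v t (x - x₀))
    {B : ℝ} (hB : ∀ y, ‖v y‖ ≤ B) :
    v = 0 ∨ ∃ c C L₀ : ℝ, 0 < c ∧ ∀ L : ℝ, L₀ ≤ L →
      c * L ^ (3 - 2 * α) ≤ ∫ y in ball (0 : EuclideanSpace ℝ (Fin 3)) L, ‖v y‖ ^ 2 ∧
        ∫ y in ball (0 : EuclideanSpace ℝ (Fin 3)) L, ‖v y‖ ^ 2 ≤ C * L ^ (3 - 2 * α) := by
  have hB0 : 0 ≤ B := (norm_nonneg _).trans (hB 0)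
  have hbd : ∀ y : EuclideanSpace ℝ (Fin 3), 0 ≤ ‖y‖ → ‖v y‖ ≤ B * ‖y‖ ^ (0 : ℝ) := fun y _ => by
    rw [Real.rpow_zero, mul_one]
    exact hB y
  have hsh := shellGrowth_of_pow_bound (r := 6) hv3.continuous hB0 le_rfl (by norm_num) hbd
  refine h T α ρ₀ x₀ u p v hT hα hα' hρ₀ hsol hreg hv3 hss ⟨6, 3,
    B ^ (6 : ℝ) * 2 ^ ((6 : ℝ) * 0) * (8 * (volume : Measure (EuclideanSpace ℝ (Fin 3))).real
      (closedBall (0 : EuclideanSpace ℝ (Fin 3)) 1)), max 0 1, by norm_num, by norm_num,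
    fun L hL => ?_⟩
  have := hsh L hL
  rw [mul_zero, add_zero] at this
  rw [mul_zero]
  exact this

/-- **BS15 Remark 1.2 (energy concentration) for BOUNDED profiles (relative to the fact).** A
locally self-similar blow-up in the class with a bounded, non-trivial profile "carries some
positive amount of energy with it, i.e. `‖u(t)‖_{L²(B_{ρ₀}(x₀))}` stays bounded away from zero as
time `t` approaches critical": there are `c > 0` and `t₁ < T` with `∫_{B_{ρ₀}(x₀)}|u(t)|² ≥ c` on
`[t₁, T)`. [cite: BronziShvydkoy2015, §1 Rem. 1.2] -/
theorem bronziShvydkoy2015_energy_dichotomy.energy_ball_lower_bound_of_bounded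
    (h : bronziShvydkoy2015_energy_dichotomy) {T α ρ₀ : ℝ} {x₀ : EuclideanSpace ℝ (Fin 3)}
    {u : ℝ → EuclideanSpace ℝ (Fin 3) → EuclideanSpace ℝ (Fin 3)}
    {p : ℝ → EuclideanSpace ℝ (Fin 3) → ℝ}
    {v : EuclideanSpace ℝ (Fin 3) → EuclideanSpace ℝ (Fin 3)}
    (hT : 0 < T) (hα : 0 < α) (hα' : α < 3 / 2) (hρ₀ : 0 < ρ₀)
    (hsol : IsClassicalEulerSolutionOn (Ico 0 T) 0 u p)
    (hreg : ∀ T'' < T, HasBoundedSobolevNormsOn (Icc 0 T'') u)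
    (hv3 : ContDiff ℝ 3 v)
    (hss : ∀ t ∈ Ico 0 T, ∀ x ∈ ball x₀ ρ₀,
      u t x = selfSimilarCollapse (1 / (α + 1)) T v t (x - x₀))
    {B : ℝ} (hB : ∀ y, ‖v y‖ ≤ B) (hv : v ≠ 0) :
    ∃ c t₁ : ℝ, 0 < c ∧ 0 ≤ t₁ ∧ t₁ < T ∧ ∀ t ∈ Ico t₁ T,
      c ≤ ∫ x in ball x₀ ρ₀, ‖u t x‖ ^ 2 := by
  have hB0 : 0 ≤ B := (norm_nonneg _).trans (hB 0)
  have hbd : ∀ y : EuclideanSpace ℝ (Fin 3), 0 ≤ ‖y‖ → ‖v y‖ ≤ B * ‖y‖ ^ (0 : ℝ) := fun y _ => by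
    rw [Real.rpow_zero, mul_one]
    exact hB y
  have hsh := shellGrowth_of_pow_bound (r := 6) hv3.continuous hB0 le_rfl (by norm_num) hbd
  refine h.energy_ball_lower_bound hT hα hα' hρ₀ hsol hreg hv3 hss ⟨6, 3,
    B ^ (6 : ℝ) * 2 ^ ((6 : ℝ) * 0) * (8 * (volume : Measure (EuclideanSpace ℝ (Fin 3))).real
      (closedBall (0 : EuclideanSpace ℝ (Fin 3)) 1)), max 0 1, by norm_num, by norm_num,
    fun L hL => ?_⟩ hv
  have := hsh L hL
  rw [mul_zero, add_zero] at this
  rw [mul_zero]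
  exact this

/-! ## Sublinear growth: (1.7) holds with `p ≥ 6/δ`; Shvydkoy's criterion without `α > (N−2)/4` -/

/-- **BS15 Theorem 1.1 for profiles of SUBLINEAR growth (relative to the fact).** If
`|v(y)| ≤ B |y|^{1−δ}` for `|y| ≥ R` with `0 < δ ≤ 1`, then (1.7) holds with `p = max 6 (6/δ)`,
`γ = 3 + p(1−δ) < p − 2` (since `pδ ≥ 6 > 5`: "for `p` large enough, we have
`γ = (p−2)(1−δ) + N − 2α < p − 2`", p. 4); hence, under the remaining hypotheses of
`bronziShvydkoy2015_energy_dichotomy`, `v = 0` or the two-sided law (1.8) holds. The sublinear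
growth bound "is natural in the sense that it breaks the scaling symmetry of the equation in
self-similar variables" (p. 4; linear profiles (1.9) exist for every exponent,
`isSelfSimilarEulerProfile_linear`). [cite: BronziShvydkoy2015, §1 Thm. 1.1 and p. 4 (sublinear growth)] -/
theorem bronziShvydkoy2015_energy_dichotomy.of_sublinear
    (h : bronziShvydkoy2015_energy_dichotomy) {T α ρ₀ : ℝ} {x₀ : EuclideanSpace ℝ (Fin 3)}
    {u : ℝ → EuclideanSpace ℝ (Fin 3) → EuclideanSpace ℝ (Fin 3)}
    {p : ℝ → EuclideanSpace ℝ (Fin 3) → ℝ}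
    {v : EuclideanSpace ℝ (Fin 3) → EuclideanSpace ℝ (Fin 3)}
    (hT : 0 < T) (hα : 0 < α) (hα' : α < 3 / 2) (hρ₀ : 0 < ρ₀)
    (hsol : IsClassicalEulerSolutionOn (Ico 0 T) 0 u p)
    (hreg : ∀ T'' < T, HasBoundedSobolevNormsOn (Icc 0 T'') u)
    (hv3 : ContDiff ℝ 3 v)
    (hss : ∀ t ∈ Ico 0 T, ∀ x ∈ ball x₀ ρ₀,
      u t x = selfSimilarCollapse (1 / (α + 1)) T v t (x - x₀))
    {B δ R : ℝ} (hδ : 0 < δ) (hδ1 : δ ≤ 1)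
    (hsub : ∀ y : EuclideanSpace ℝ (Fin 3), R ≤ ‖y‖ → ‖v y‖ ≤ B * ‖y‖ ^ (1 - δ)) :
    v = 0 ∨ ∃ c C L₀ : ℝ, 0 < c ∧ ∀ L : ℝ, L₀ ≤ L →
      c * L ^ (3 - 2 * α) ≤ ∫ y in ball (0 : EuclideanSpace ℝ (Fin 3)) L, ‖v y‖ ^ 2 ∧
        ∫ y in ball (0 : EuclideanSpace ℝ (Fin 3)) L, ‖v y‖ ^ 2 ≤ C * L ^ (3 - 2 * α) := by
  -- `B ≥ 0` may be assumed (replace `B` by `max B 0`)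
  have hsub' : ∀ y : EuclideanSpace ℝ (Fin 3), R ≤ ‖y‖ → ‖v y‖ ≤ max B 0 * ‖y‖ ^ (1 - δ) :=
    fun y hy => (hsub y hy).trans (mul_le_mul_of_nonneg_right (le_max_left _ _)
      (Real.rpow_nonneg (norm_nonneg _) _))
  set r : ℝ := max 6 (6 / δ) with hr_def
  have hr6 : 6 ≤ r := le_max_left _ _
  have hrδ : 6 ≤ r * δ := by
    have : 6 / δ ≤ r := le_max_right _ _
    have := mul_le_mul_of_nonneg_right this hδ.le
    rwa [div_mul_cancel₀ _ hδ.ne'] at this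
  have hsh := shellGrowth_of_pow_bound (r := r) hv3.continuous (le_max_right _ _)
    (by linarith : (0 : ℝ) ≤ 1 - δ) (by linarith) hsub'
  exact h T α ρ₀ x₀ u p v hT hα hα' hρ₀ hsol hreg hv3 hss
    ⟨r, 3 + r * (1 - δ), _, max R 1, by linarith, by nlinarith, hsh⟩

/-- **Shvydkoy's sublinear-growth criterion, improved (BS15 p. 4; relative to the fact).** "if
`|v(y)| ≲ |y|^{1−δ}`, for some `δ > 0`, and `∫_{|y|<L}|v(y)|² dy ≲ L^{N−2α} o(1)` with
`α > (N−2)/4`, then `v = 0` [Shvydkoy 2013]. We can now remove the extra assumption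
`α > (N−2)/4`." Statement: under the hypotheses of `bronziShvydkoy2015_energy_dichotomy` except
(1.7), a profile with `|v(y)| ≤ B|y|^{1−δ}` for `|y| ≥ R` (`0 < δ ≤ 1`) whose rescaled energy
`L^{2α−3}∫_{|y|<L}|v|²` is frequently small vanishes identically, for EVERY `0 < α < 3/2`.
[cite: BronziShvydkoy2015, §1 p. 4 (after Rem. 1.3)] -/
theorem bronziShvydkoy2015_energy_dichotomy.eq_zero_of_sublinear_of_frequently_small
    (h : bronziShvydkoy2015_energy_dichotomy) {T α ρ₀ : ℝ} {x₀ : EuclideanSpace ℝ (Fin 3)}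
    {u : ℝ → EuclideanSpace ℝ (Fin 3) → EuclideanSpace ℝ (Fin 3)}
    {p : ℝ → EuclideanSpace ℝ (Fin 3) → ℝ}
    {v : EuclideanSpace ℝ (Fin 3) → EuclideanSpace ℝ (Fin 3)}
    (hT : 0 < T) (hα : 0 < α) (hα' : α < 3 / 2) (hρ₀ : 0 < ρ₀)
    (hsol : IsClassicalEulerSolutionOn (Ico 0 T) 0 u p)
    (hreg : ∀ T'' < T, HasBoundedSobolevNormsOn (Icc 0 T'') u)
    (hv3 : ContDiff ℝ 3 v)
    (hss : ∀ t ∈ Ico 0 T, ∀ x ∈ ball x₀ ρ₀,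
      u t x = selfSimilarCollapse (1 / (α + 1)) T v t (x - x₀))
    {B δ R : ℝ} (hδ : 0 < δ) (hδ1 : δ ≤ 1)
    (hsub : ∀ y : EuclideanSpace ℝ (Fin 3), R ≤ ‖y‖ → ‖v y‖ ≤ B * ‖y‖ ^ (1 - δ))
    (hsmall : ∀ ε : ℝ, 0 < ε → ∀ M : ℝ, ∃ L : ℝ, M ≤ L ∧
      L ^ (2 * α - 3) * ∫ y in ball (0 : EuclideanSpace ℝ (Fin 3)) L, ‖v y‖ ^ 2 ≤ ε) :
    v = 0 := by
  rcases h.of_sublinear hT hα hα' hρ₀ hsol hreg hv3 hss hδ hδ1 hsub with h0 | ⟨c, C, L₀, hc, hbd⟩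
  · exact h0
  · exfalso
    obtain ⟨L, hML, hL⟩ := hsmall (c / 2) (by positivity) (max L₀ 1)
    have hL1 : 1 ≤ L := (le_max_right _ _).trans hML
    have hL0 : 0 < L := by linarith
    have hlow := (hbd L ((le_max_left _ _).trans hML)).1
    have hpow : 0 < L ^ (2 * α - 3) := Real.rpow_pos_of_pos hL0 _
    have hone : L ^ (2 * α - 3) * L ^ (3 - 2 * α) = 1 := by
      rw [← Real.rpow_add hL0, show 2 * α - 3 + (3 - 2 * α) = 0 by ring, Real.rpow_zero]
    have : c ≤ c / 2 :=
      calc c = L ^ (2 * α - 3) * (c * L ^ (3 - 2 * α)) := by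
            rw [mul_left_comm, hone, mul_one]
        _ ≤ L ^ (2 * α - 3) * ∫ y in ball (0 : EuclideanSpace ℝ (Fin 3)) L, ‖v y‖ ^ 2 :=
            mul_le_mul_of_nonneg_left hlow hpow.le
        _ ≤ c / 2 := hL
    linarith

/-! ## Remark 1.2, local energy dimension `3 − 2α` (general class) -/

/-- For `0 < ρ`, `0 < s ≤ T₀ (ρ/M)^{α+1}` (`M, T₀ > 0`, `α > −1`) the rescaled radius satisfies
`M T₀^{−1/(α+1)} ≤ ρ s^{−1/(α+1)}` (copy of the private tool of
`SelfSimilarEulerLocalEnergyDimension.lean`). [folklore] -/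
private theorem rescaledRadius_ge' {α M T₀ s ρ : ℝ} (hα : -1 < α) (hM : 0 < M) (hT₀ : 0 < T₀)
    (hs : 0 < s) (hρ : 0 < ρ) (hsle : s ≤ T₀ * (ρ / M) ^ (α + 1)) :
    M * T₀ ^ (-(1 / (α + 1))) ≤ ρ * s ^ (-(1 / (α + 1))) := by
  have hα1 : 0 < α + 1 := by linarith
  have hρM : 0 < ρ / M := div_pos hρ hM
  have h1 : (T₀ * (ρ / M) ^ (α + 1)) ^ (-(1 / (α + 1))) ≤ s ^ (-(1 / (α + 1))) :=
    Real.rpow_le_rpow_of_nonpos hs hsle (by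
      have : 0 < 1 / (α + 1) := by positivity
      linarith)
  have h2 : (T₀ * (ρ / M) ^ (α + 1)) ^ (-(1 / (α + 1))) = T₀ ^ (-(1 / (α + 1))) * (M / ρ) := by
    rw [Real.mul_rpow hT₀.le (Real.rpow_pos_of_pos hρM _).le, ← Real.rpow_mul hρM.le]
    have : (α + 1) * -(1 / (α + 1)) = -1 := by field_simp
    rw [this, Real.rpow_neg_one, inv_div]
  rw [h2] at h1
  calc M * T₀ ^ (-(1 / (α + 1))) = ρ * (T₀ ^ (-(1 / (α + 1))) * (M / ρ)) := by
        field_simp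
    _ ≤ ρ * s ^ (-(1 / (α + 1))) := by gcongr

/-- **LOWER bound on every small ball (general class, relative to the fact).** Under the hypotheses
of `bronziShvydkoy2015_energy_dichotomy` with `v ≠ 0` there are `c > 0` and `M > 0` such that for
every `0 < ρ ≤ ρ₀` and every `0 ≤ t < T` with `T − t ≤ T (ρ/M)^{α+1}` one has
`c ρ^{3−2α} ≤ ∫_{B_ρ(x₀)} |u(t)|²`, `c` independent of `ρ` (the lower half of (1.8) transported by
the exact scaling (1.5)). [cite: BronziShvydkoy2015, §1 Thm. 1.1 and Rem. 1.2 (eq. (1.5))] -/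
theorem bronziShvydkoy2015_energy_dichotomy.localEnergy_ge
    (h : bronziShvydkoy2015_energy_dichotomy) {T α ρ₀ : ℝ} {x₀ : EuclideanSpace ℝ (Fin 3)}
    {u : ℝ → EuclideanSpace ℝ (Fin 3) → EuclideanSpace ℝ (Fin 3)}
    {p : ℝ → EuclideanSpace ℝ (Fin 3) → ℝ}
    {v : EuclideanSpace ℝ (Fin 3) → EuclideanSpace ℝ (Fin 3)}
    (hT : 0 < T) (hα : 0 < α) (hα' : α < 3 / 2) (hρ₀ : 0 < ρ₀)
    (hsol : IsClassicalEulerSolutionOn (Ico 0 T) 0 u p)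
    (hreg : ∀ T'' < T, HasBoundedSobolevNormsOn (Icc 0 T'') u)
    (hv3 : ContDiff ℝ 3 v)
    (hss : ∀ t ∈ Ico 0 T, ∀ x ∈ ball x₀ ρ₀,
      u t x = selfSimilarCollapse (1 / (α + 1)) T v t (x - x₀))
    (hgrowth : ∃ r γ C L₀ : ℝ, 3 ≤ r ∧ γ < r - 2 ∧ ∀ L : ℝ, L₀ ≤ L →
      ∫ y in {y : EuclideanSpace ℝ (Fin 3) | L < ‖y‖ ∧ ‖y‖ < 2 * L}, ‖v y‖ ^ r ≤ C * L ^ γ)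
    (hv : v ≠ 0) :
    ∃ c M : ℝ, 0 < c ∧ 0 < M ∧ ∀ ρ : ℝ, 0 < ρ → ρ ≤ ρ₀ → ∀ t ∈ Ico 0 T,
      T - t ≤ T * (ρ / M) ^ (α + 1) → c * ρ ^ (3 - 2 * α) ≤ ∫ x in ball x₀ ρ, ‖u t x‖ ^ 2 := by
  obtain ⟨c, C, L₀, hc, hbd⟩ :=
    (h T α ρ₀ x₀ u p v hT hα hα' hρ₀ hsol hreg hv3 hss hgrowth).resolve_left hv
  have hα1 : -1 < α := by linarith
  -- `M := max L₀ 1 · T^{γ}` so that `M T^{-γ} = max L₀ 1`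
  set M : ℝ := max L₀ 1 * T ^ (1 / (α + 1)) with hM_def
  have hM1 : 0 < max L₀ 1 := lt_of_lt_of_le one_pos (le_max_right _ _)
  have hM : 0 < M := mul_pos hM1 (Real.rpow_pos_of_pos hT _)
  have hMT : M * T ^ (-(1 / (α + 1))) = max L₀ 1 := by
    rw [hM_def, mul_assoc, ← Real.rpow_add hT, add_neg_cancel, Real.rpow_zero, mul_one]
  refine ⟨c, M, hc, hM, fun ρ hρ hρle t ht hclose => ?_⟩
  have hs : 0 < T - t := sub_pos.mpr ht.2
  set L : ℝ := ρ * (T - t) ^ (-(1 / (α + 1))) with hL_def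
  have hL1 : M * T ^ (-(1 / (α + 1))) ≤ L := rescaledRadius_ge' hα1 hM hT hs hρ hclose
  have hL₀L : L₀ ≤ L := (le_max_left _ _).trans (hMT ▸ hL1)
  have hlow : c * L ^ (3 - 2 * α) ≤
      ∫ y in ball (0 : EuclideanSpace ℝ (Fin 3)) L, ‖v y‖ ^ 2 := (hbd L hL₀L).1
  have hpre : 0 < (T - t) ^ (2 * (1 / (α + 1) - 1) + 3 * (1 / (α + 1))) :=
    Real.rpow_pos_of_pos hs _
  have hss' : ∀ t ∈ Ico 0 T, ∀ x ∈ ball x₀ ρ,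
      u t x = selfSimilarCollapse (1 / (α + 1)) T v t (x - x₀) := fun t ht x hx =>
    hss t ht x (ball_subset_ball hρle hx)
  rw [localEnergy_eq_of_locallySelfSimilar hss' ht le_rfl]
  calc c * ρ ^ (3 - 2 * α)
      = (T - t) ^ (2 * (1 / (α + 1) - 1) + 3 * (1 / (α + 1))) * (c * L ^ (3 - 2 * α)) := by
        rw [hL_def, ← collapse_scaling_identity hα1 ht.2 hρ]; ring
    _ ≤ (T - t) ^ (2 * (1 / (α + 1) - 1) + 3 * (1 / (α + 1))) *
          ∫ y in ball (0 : EuclideanSpace ℝ (Fin 3)) L, ‖v y‖ ^ 2 :=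
        mul_le_mul_of_nonneg_left hlow hpre.le

/-- **Bronzi–Shvydkoy 2015, Remark 1.2 — the local energy dimension is exactly `3 − 2α`
(general class, relative to the fact).** Under the hypotheses of
`bronziShvydkoy2015_energy_dichotomy` with `v ≠ 0` there are `0 < c ≤ C` and `M > 0` such that
for every ball `B_ρ(x₀)`, `0 < ρ ≤ ρ₀`, and all `t ∈ [0, T)` with `T − t ≤ T (ρ/M)^{α+1}`:
`c ρ^{3−2α} ≤ ∫_{B_ρ(x₀)} |u(t,x)|² dx ≤ C ρ^{3−2α}` ("As a consequence of (1.8),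
`𝓔_T(B_ρ(x₀)) ∼ lim_{L→∞} L^{2α−N}∫_{|y|<ρL}|v|² ∼ ρ^{N−2α}`, for all small `ρ`. This implies that in
the case of non-trivial self-similar blow-up satisfying (1.7) the exact fractal local dimension of
`𝓔_T` exists at `x₀` and is equal to `D = N − 2α`"). The upper half is the unconditional
`localEnergy_le_of_locallySelfSimilar` ((1.5)–(1.6)); the `L^p`-class version of the whole statement,
unconditional, is `localEnergy_two_sided_of_locallySelfSimilar_of_memLp`.
[cite: BronziShvydkoy2015, §1 Rem. 1.2 (with Thm. 1.1, eqs. (1.5)–(1.6))] -/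
theorem bronziShvydkoy2015_energy_dichotomy.localEnergy_two_sided
    (h : bronziShvydkoy2015_energy_dichotomy) {T α ρ₀ : ℝ} {x₀ : EuclideanSpace ℝ (Fin 3)}
    {u : ℝ → EuclideanSpace ℝ (Fin 3) → EuclideanSpace ℝ (Fin 3)}
    {p : ℝ → EuclideanSpace ℝ (Fin 3) → ℝ}
    {v : EuclideanSpace ℝ (Fin 3) → EuclideanSpace ℝ (Fin 3)}
    (hT : 0 < T) (hα : 0 < α) (hα' : α < 3 / 2) (hρ₀ : 0 < ρ₀)
    (hsol : IsClassicalEulerSolutionOn (Ico 0 T) 0 u p)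
    (hreg : ∀ T'' < T, HasBoundedSobolevNormsOn (Icc 0 T'') u)
    (hv3 : ContDiff ℝ 3 v)
    (hss : ∀ t ∈ Ico 0 T, ∀ x ∈ ball x₀ ρ₀,
      u t x = selfSimilarCollapse (1 / (α + 1)) T v t (x - x₀))
    (hgrowth : ∃ r γ C L₀ : ℝ, 3 ≤ r ∧ γ < r - 2 ∧ ∀ L : ℝ, L₀ ≤ L →
      ∫ y in {y : EuclideanSpace ℝ (Fin 3) | L < ‖y‖ ∧ ‖y‖ < 2 * L}, ‖v y‖ ^ r ≤ C * L ^ γ)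
    (hv : v ≠ 0) :
    ∃ c C M : ℝ, 0 < c ∧ c ≤ C ∧ 0 < M ∧ ∀ ρ : ℝ, 0 < ρ → ρ ≤ ρ₀ → ∀ t ∈ Ico 0 T,
      T - t ≤ T * (ρ / M) ^ (α + 1) →
        c * ρ ^ (3 - 2 * α) ≤ ∫ x in ball x₀ ρ, ‖u t x‖ ^ 2 ∧
          ∫ x in ball x₀ ρ, ‖u t x‖ ^ 2 ≤ C * ρ ^ (3 - 2 * α) := by
  have hα1 : -1 < α := by linarith
  obtain ⟨c, M, hc, hM, hlow⟩ :=
    h.localEnergy_ge hT hα hα' hρ₀ hsol hreg hv3 hss hgrowth hv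
  set K : ℝ := (∫ x, ‖u 0 x‖ ^ 2) * ρ₀ ^ (2 * α - 3) with hK_def
  -- common threshold: `M' = max M ρ₀`
  set M' : ℝ := max M ρ₀ with hM'_def
  have hM' : 0 < M' := lt_max_of_lt_left hM
  have hmono : ∀ {ρ A B : ℝ}, 0 < ρ → 0 < A → A ≤ B →
      T * (ρ / B) ^ (α + 1) ≤ T * (ρ / A) ^ (α + 1) := by
    intro ρ A B hρ hA hAB
    have : ρ / B ≤ ρ / A := div_le_div_of_nonneg_left hρ.le hA hAB
    have hB : 0 ≤ ρ / B := div_nonneg hρ.le (hA.le.trans hAB)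
    gcongr
  refine ⟨c, max c K, M', hc, le_max_left _ _, hM', fun ρ hρ hρle t ht hclose => ⟨?_, ?_⟩⟩
  · exact hlow ρ hρ hρle t ht (hclose.trans (hmono hρ hM (le_max_left _ _)))
  · have hup := localEnergy_le_of_locallySelfSimilar hT hα1 hρ₀ hsol hreg hss ht hρ hρle
      (hclose.trans (hmono hρ hρ₀ (le_max_right _ _)))
    exact hup.trans (mul_le_mul_of_nonneg_right (le_max_right _ _)
      (Real.rpow_nonneg hρ.le _))

end Literature.Analysis.FluidPDE
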